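import Summits.BirchSwinnertonDyer.BirchSwinnertonDyer.Theorems.ByReductionTypeAtTwoFineSelmerConjAAtTwoAdditivePotGoodClassNumberOne780
import Summits.BirchSwinnertonDyer.BirchSwinnertonDyer.Theorems.ByReductionTypeAtTwoFineSelmerConjAAtTwoAdditivePotGoodPresentationDoor
import HarnessLib

/-!
# Route `ByReductionTypeAtTwo` (rung K4), crux C1″ `FineSelmerConjAAtTwoAdditivePotGood` (item stmt-BirchSwinnertonDyer-22615):
# CLASS NUMBER ONE FOR THE CUBIC FIELD OF DISCRIMINANT `−2892` (`X³ − X² − 13X − 17`) BY AN EXPLICIT MINKOWSKI CERTIFICATE (KERNEL),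
# hence Iwasawa's `μ₂ = 0` for it UNCONDITIONALLY — the `2`-torsion field of the census row `242928t1`
# (a `--supports 22615` file; seat `bsd-2adic-k4-w1` GEN 4; third consumer of `…ExplicitMinkowski`)

HONEST FRAMING (cell `bsd-2adic`, D-0036/D-0054): UNCONDITIONAL kernel theorems; closes nothing at the `∀`-level; nothing booked;
BSD is not proved by any of this.

THE CERTIFICATE. `g = X³ − X² − 13X − 17`, `disc g = −2892`, `|d_K| ≤ 2892`, `M_K ≤ (4/3.14)(6/27)√2892 < 16`. `g` is irreducible (no root
mod `11`). Congruences used: `g ≡ (X + 1)³ (mod 2)`, `g ≡ (X − 1)²(X − 2) (mod 3)`. Generators (norms by companion determinants):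
`α₂ = −7 − 7θ − 2θ² = (θ + 1)(−2θ − 5) − 2` (`N = −2`); above `3`: `−2 − θ` (`θ ≡ 1`, `N = −3`), `θ² − 2θ − 12` (`θ ≡ 2`, `N = 3`);
above `5`: `−θ² + 7θ − 11` (`θ ≡ 1`, `N = 5`); above `7`: `2θ² − 6θ − 15` (`θ ≡ 4`, `N = −7`); above `13`: `−θ² − 3θ − 3` (`θ ≡ 2`,
`N = −13`); `11` has no root. Norm values `4, 8, 9, 6, 10, 12, 14, 15` are excluded (`N(I) ∣ ℓ³` for `ℓ ∈ I`; `2 ∈ I ⟹ α₂ ∈ I`;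
`9`: `(θ − 1)²(θ − 2) ∈ (3) ⊆ I`).

* §1 `irreducible_cubic_disc_neg2892`, **`classNumber_eq_one_of_root_disc_neg2892`**.
* §2 `card_classGroup_adjoin_eq_one_disc_neg2892`; **`classicalMuVanishes_cubicField_disc_neg2892`**: `μ₂ = 0` along EVERY `ℤ₂`-extension
  of `ℚ(θ)`, `θ³ = θ² + 13θ + 17` — UNCONDITIONAL (`2 = 𝔭³`: `θ + 1` is a root of the Eisenstein cubic `X³ − 4X² − 8X − 6`).

References: [Marcus1977] Ch. 5, Thm. 35–37; [Cohen1993] §6.3, App. B (d = −2892, h = 1); [Greenberg2001IwasawaPastPresent] Prop. 2.1.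
-/

set_option autoImplicit false
-- sibling precedent (`…ClassNumberOne780.lean`): the directory name repeats the summit name
set_option linter.dupNamespace false

noncomputable section

open scoped Classical IntermediateField NumberField Real nonZeroDivisors

namespace Summit.BirchSwinnertonDyer.BirchSwinnertonDyer.Theorems.AddKatoTwo

open Polynomial IsDedekindDomain NumberField Matrix Literature.NumberTheory.EllipticCurves Literature.NumberTheory.IwasawaTheory

/-- `X³ − X² − 13X − 17` is irreducible over `ℚ` (no root mod `11`). -/
theorem irreducible_cubic_disc_neg2892 : Irreducible (Cubic.toPoly ⟨1, ((-1 : ℤ) : ℚ), ((-13 : ℤ) : ℚ), ((-17 : ℤ) : ℚ)⟩) :=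
  haveI : Fact (Nat.Prime 11) := ⟨by norm_num⟩
  irreducible_cubic_of_no_root_zmod 11 (by decide)

section Certificate

variable (K : Type) [Field K] [NumberField K]

/-- Companion-determinant norms of the six generators of the certificate for `X³ − X² − 13X − 17`: `−2, −3, 3, 5, −7, −13`. -/
private theorem dets_disc_neg2892 :
    (((-7 : ℤ) : ℚ) • (1 : Matrix (Fin 3) (Fin 3) ℚ) + ((-7 : ℤ) : ℚ) • !![(0 : ℚ), 0, -(-17 : ℤ); 1, 0, -(-13 : ℤ); 0, 1, -(-1 : ℤ)] +
        ((-2 : ℤ) : ℚ) • !![(0 : ℚ), 0, -(-17 : ℤ); 1, 0, -(-13 : ℤ); 0, 1, -(-1 : ℤ)] ^ 2).det = -2 ∧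
    (((-2 : ℤ) : ℚ) • (1 : Matrix (Fin 3) (Fin 3) ℚ) + ((-1 : ℤ) : ℚ) • !![(0 : ℚ), 0, -(-17 : ℤ); 1, 0, -(-13 : ℤ); 0, 1, -(-1 : ℤ)] +
        ((0 : ℤ) : ℚ) • !![(0 : ℚ), 0, -(-17 : ℤ); 1, 0, -(-13 : ℤ); 0, 1, -(-1 : ℤ)] ^ 2).det = -3 ∧
    (((-12 : ℤ) : ℚ) • (1 : Matrix (Fin 3) (Fin 3) ℚ) + ((-2 : ℤ) : ℚ) • !![(0 : ℚ), 0, -(-17 : ℤ); 1, 0, -(-13 : ℤ); 0, 1, -(-1 : ℤ)] +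
        ((1 : ℤ) : ℚ) • !![(0 : ℚ), 0, -(-17 : ℤ); 1, 0, -(-13 : ℤ); 0, 1, -(-1 : ℤ)] ^ 2).det = 3 ∧
    (((-11 : ℤ) : ℚ) • (1 : Matrix (Fin 3) (Fin 3) ℚ) + ((7 : ℤ) : ℚ) • !![(0 : ℚ), 0, -(-17 : ℤ); 1, 0, -(-13 : ℤ); 0, 1, -(-1 : ℤ)] +
        ((-1 : ℤ) : ℚ) • !![(0 : ℚ), 0, -(-17 : ℤ); 1, 0, -(-13 : ℤ); 0, 1, -(-1 : ℤ)] ^ 2).det = 5 ∧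
    (((-15 : ℤ) : ℚ) • (1 : Matrix (Fin 3) (Fin 3) ℚ) + ((-6 : ℤ) : ℚ) • !![(0 : ℚ), 0, -(-17 : ℤ); 1, 0, -(-13 : ℤ); 0, 1, -(-1 : ℤ)] +
        ((2 : ℤ) : ℚ) • !![(0 : ℚ), 0, -(-17 : ℤ); 1, 0, -(-13 : ℤ); 0, 1, -(-1 : ℤ)] ^ 2).det = -7 ∧
    (((-3 : ℤ) : ℚ) • (1 : Matrix (Fin 3) (Fin 3) ℚ) + ((-3 : ℤ) : ℚ) • !![(0 : ℚ), 0, -(-17 : ℤ); 1, 0, -(-13 : ℤ); 0, 1, -(-1 : ℤ)] +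
        ((-1 : ℤ) : ℚ) • !![(0 : ℚ), 0, -(-17 : ℤ); 1, 0, -(-13 : ℤ); 0, 1, -(-1 : ℤ)] ^ 2).det = -13 := by
  refine ⟨?_, ?_, ?_, ?_, ?_, ?_⟩ <;>
  · simp [Matrix.det_fin_three, sq]
    norm_num

/-- **`h = 1` for every cubic number field containing a root `θ` of `X³ − X² − 13X − 17`** (the field of discriminant `−2892`), by the
explicit Minkowski certificate of the module docstring. KERNEL. [cite: Marcus1977, Ch. 5 Thm. 37 and Cor. 2]
[cite: Cohen1993, App. B (complex cubic fields: d = −2892, h = 1)] -/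
theorem classNumber_eq_one_of_root_disc_neg2892 (h3 : Module.finrank ℚ K = 3) (b : 𝓞 K)
    (hb : b ^ 3 + (-1 : ℤ) * b ^ 2 + (-13 : ℤ) * b + (-17 : ℤ) = 0) : NumberField.classNumber K = 1 := by
  have hirr := irreducible_cubic_disc_neg2892
  have hd : |NumberField.discr K| ≤ (2892 : ℕ) :=
    (abs_discr_le_abs_cubic_discr K h3 b hirr hb).trans (by simp only [Cubic.discr]; norm_num)
  have hM := minkowskiBound_lt_of_sqrt_le K h3 hd (s := 53.78) (B := 16)
    ((Real.sqrt_le_sqrt (by norm_num : ((2892 : ℕ) : ℝ) ≤ (53.78 : ℝ) ^ 2)).trans (Real.sqrt_sq (by norm_num)).le)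
    (by norm_num)
  obtain ⟨hN2, hN3a, hN3b, hN5, hN7, hN13⟩ := dets_disc_neg2892
  have hb' : b ^ 3 - b ^ 2 - 13 * b - 17 = 0 := by push_cast at hb; linear_combination hb
  rw [NumberField.classNumber_eq_one_iff]
  refine RingOfIntegers.isPrincipalIdealRing_of_isPrincipal_of_norm_le_of_isPrime fun I hI hle ↦ ?_
  have hlt : Ideal.absNorm (I : Ideal (𝓞 K)) < 16 := by exact_mod_cast hle.trans_lt hM
  have h0 : Ideal.absNorm (I : Ideal (𝓞 K)) ≠ 0 := Ideal.absNorm_ne_zero_of_nonZeroDivisors I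
  have h1 : Ideal.absNorm (I : Ideal (𝓞 K)) ≠ 1 := by rw [Ne, Ideal.absNorm_eq_one_iff]; exact hI.ne_top
  have hmemN := Ideal.absNorm_mem (I : Ideal (𝓞 K))
  have nα2 := natAbs_norm_coords_eq K h3 b hirr hb (-7) (-7) (-2) (n := 2) hN2 (by norm_num)
  have nα3a := natAbs_norm_coords_eq K h3 b hirr hb (-2) (-1) 0 (n := 3) hN3a (by norm_num)
  have nα3b := natAbs_norm_coords_eq K h3 b hirr hb (-12) (-2) 1 (n := 3) hN3b (by norm_num)
  have nα5 := natAbs_norm_coords_eq K h3 b hirr hb (-11) 7 (-1) (n := 5) hN5 (by norm_num)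
  have nα7 := natAbs_norm_coords_eq K h3 b hirr hb (-15) (-6) 2 (n := 7) hN7 (by norm_num)
  have nα13 := natAbs_norm_coords_eq K h3 b hirr hb (-3) (-3) (-1) (n := 13) hN13 (by norm_num)
  have hdvl : ∀ ℓ : ℕ, ((ℓ : ℕ) : 𝓞 K) ∈ (I : Ideal (𝓞 K)) → Ideal.absNorm (I : Ideal (𝓞 K)) ∣ ℓ ^ 3 :=
    fun ℓ h => absNorm_dvd_pow_three_of_natCast_mem K h3 h
  -- `2 ∈ I ⟹ θ + 1 ∈ I ⟹ α₂ ∈ I`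
  have key2 : ((2 : ℕ) : 𝓞 K) ∈ (I : Ideal (𝓞 K)) →
      (((-7 : ℤ) : 𝓞 K) + ((-7 : ℤ) : 𝓞 K) * b + ((-2 : ℤ) : 𝓞 K) * b ^ 2) ∈ (I : Ideal (𝓞 K)) := by
    intro h2
    have hb1 : b + 1 ∈ (I : Ideal (𝓞 K)) := by
      apply hI.mem_of_pow_mem 3
      have : (b + 1) ^ 3 = ((2 : ℕ) : 𝓞 K) * (-(-2 * b ^ 2 - 8 * b - 9)) := by push_cast; linear_combination hb'
      rw [this]; exact Ideal.mul_mem_right _ _ h2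
    have : (((-7 : ℤ) : 𝓞 K) + ((-7 : ℤ) : 𝓞 K) * b + ((-2 : ℤ) : 𝓞 K) * b ^ 2) =
        (b + 1) * (-2 * b - 5) + ((2 : ℕ) : 𝓞 K) * (-1) := by push_cast; ring
    rw [this]
    exact Ideal.add_mem _ (Ideal.mul_mem_right _ _ hb1) (Ideal.mul_mem_right _ _ h2)
  -- above `3`: `θ ≡ 1` or `θ ≡ 2`
  have gen3a : b - ((1 : ℕ) : 𝓞 K) ∈ (I : Ideal (𝓞 K)) → ((3 : ℕ) : 𝓞 K) ∈ (I : Ideal (𝓞 K)) →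
      (((-2 : ℤ) : 𝓞 K) + ((-1 : ℤ) : 𝓞 K) * b + ((0 : ℤ) : 𝓞 K) * b ^ 2) ∈ (I : Ideal (𝓞 K)) := by
    intro hb1 h3m
    have : (((-2 : ℤ) : 𝓞 K) + ((-1 : ℤ) : 𝓞 K) * b + ((0 : ℤ) : 𝓞 K) * b ^ 2) =
        (b - ((1 : ℕ) : 𝓞 K)) * (-1) + ((3 : ℕ) : 𝓞 K) * (-1) := by push_cast; ring
    rw [this]; exact Ideal.add_mem _ (Ideal.mul_mem_right _ _ hb1) (Ideal.mul_mem_right _ _ h3m)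
  have gen3b : b - ((2 : ℕ) : 𝓞 K) ∈ (I : Ideal (𝓞 K)) → ((3 : ℕ) : 𝓞 K) ∈ (I : Ideal (𝓞 K)) →
      (((-12 : ℤ) : 𝓞 K) + ((-2 : ℤ) : 𝓞 K) * b + ((1 : ℤ) : 𝓞 K) * b ^ 2) ∈ (I : Ideal (𝓞 K)) := by
    intro hb2 h3m
    have : (((-12 : ℤ) : 𝓞 K) + ((-2 : ℤ) : 𝓞 K) * b + ((1 : ℤ) : 𝓞 K) * b ^ 2) =
        (b - ((2 : ℕ) : 𝓞 K)) * b + ((3 : ℕ) : 𝓞 K) * (-4) := by push_cast; ring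
    rw [this]; exact Ideal.add_mem _ (Ideal.mul_mem_right _ _ hb2) (Ideal.mul_mem_right _ _ h3m)
  have h2le : 2 ≤ Ideal.absNorm (I : Ideal (𝓞 K)) := by omega
  interval_cases hn : Ideal.absNorm (I : Ideal (𝓞 K))
  · -- 2
    have h2 : ((2 : ℕ) : 𝓞 K) ∈ (I : Ideal (𝓞 K)) := hmemN
    exact ⟨⟨_, eq_span_singleton_of_mem_of_absNorm_eq K two_ne_zero hn (key2 h2) nα2⟩⟩
  · -- 3
    have h3m : ((3 : ℕ) : 𝓞 K) ∈ (I : Ideal (𝓞 K)) := hmemN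
    obtain ⟨a, ha, hab⟩ := exists_sub_natCast_mem_of_absNorm_eq_prime K (by norm_num) hn b
    have hdvd := natCast_dvd_of_sub_mem K (by norm_num) hn h3 hb hab
    interval_cases a
    · norm_num at hdvd
    · exact ⟨⟨_, eq_span_singleton_of_mem_of_absNorm_eq K (by norm_num) hn (gen3a hab h3m) nα3a⟩⟩
    · exact ⟨⟨_, eq_span_singleton_of_mem_of_absNorm_eq K (by norm_num) hn (gen3b hab h3m) nα3b⟩⟩
  · -- 4
    exfalso
    have h4 : ((4 : ℕ) : 𝓞 K) ∈ (I : Ideal (𝓞 K)) := hmemN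
    have h2 : ((2 : ℕ) : 𝓞 K) ∈ (I : Ideal (𝓞 K)) := by
      have : ((4 : ℕ) : 𝓞 K) = ((2 : ℕ) : 𝓞 K) * ((2 : ℕ) : 𝓞 K) := by push_cast; norm_num
      rw [this] at h4; exact (hI.mem_or_mem h4).elim id id
    have hdvd := Ideal.absNorm_dvd_absNorm_of_le ((Ideal.span_singleton_le_iff_mem _).mpr (key2 h2))
    rw [Ideal.absNorm_span_singleton, nα2, hn] at hdvd; omega
  · -- 5
    have h5m : ((5 : ℕ) : 𝓞 K) ∈ (I : Ideal (𝓞 K)) := hmemN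
    obtain ⟨a, ha, hab⟩ := exists_sub_natCast_mem_of_absNorm_eq_prime K (by norm_num) hn b
    have hdvd := natCast_dvd_of_sub_mem K (by norm_num) hn h3 hb hab
    interval_cases a
    · norm_num at hdvd
    · refine ⟨⟨_, eq_span_singleton_of_mem_of_absNorm_eq K (by norm_num) hn ?_ nα5⟩⟩
      have : (((-11 : ℤ) : 𝓞 K) + ((7 : ℤ) : 𝓞 K) * b + ((-1 : ℤ) : 𝓞 K) * b ^ 2) =
          (b - ((1 : ℕ) : 𝓞 K)) * (-b + 6) + ((5 : ℕ) : 𝓞 K) * (-1) := by push_cast; ring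
      rw [this]; exact Ideal.add_mem _ (Ideal.mul_mem_right _ _ hab) (Ideal.mul_mem_right _ _ h5m)
    all_goals norm_num at hdvd
  · -- 6
    exfalso
    have h6 : ((6 : ℕ) : 𝓞 K) ∈ (I : Ideal (𝓞 K)) := hmemN
    have : ((6 : ℕ) : 𝓞 K) = ((2 : ℕ) : 𝓞 K) * ((3 : ℕ) : 𝓞 K) := by push_cast; norm_num
    rw [this] at h6
    rcases hI.mem_or_mem h6 with h | h
    · have := hdvl 2 h; norm_num at this
    · have := hdvl 3 h; norm_num at this
  · -- 7
    have h7m : ((7 : ℕ) : 𝓞 K) ∈ (I : Ideal (𝓞 K)) := hmemN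
    obtain ⟨a, ha, hab⟩ := exists_sub_natCast_mem_of_absNorm_eq_prime K (by norm_num) hn b
    have hdvd := natCast_dvd_of_sub_mem K (by norm_num) hn h3 hb hab
    interval_cases a
    pick_goal 5
    · refine ⟨⟨_, eq_span_singleton_of_mem_of_absNorm_eq K (by norm_num) hn ?_ nα7⟩⟩
      have : (((-15 : ℤ) : 𝓞 K) + ((-6 : ℤ) : 𝓞 K) * b + ((2 : ℤ) : 𝓞 K) * b ^ 2) =
          (b - ((4 : ℕ) : 𝓞 K)) * (2 * b + 2) + ((7 : ℕ) : 𝓞 K) * (-1) := by push_cast; ring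
      rw [this]; exact Ideal.add_mem _ (Ideal.mul_mem_right _ _ hab) (Ideal.mul_mem_right _ _ h7m)
    all_goals norm_num at hdvd
  · -- 8
    exfalso
    have h8 : ((8 : ℕ) : 𝓞 K) ∈ (I : Ideal (𝓞 K)) := hmemN
    have h2 : ((2 : ℕ) : 𝓞 K) ∈ (I : Ideal (𝓞 K)) := by
      apply hI.mem_of_pow_mem 3
      have : ((2 : ℕ) : 𝓞 K) ^ 3 = ((8 : ℕ) : 𝓞 K) := by push_cast; norm_num
      rwa [this]
    have hdvd := Ideal.absNorm_dvd_absNorm_of_le ((Ideal.span_singleton_le_iff_mem _).mpr (key2 h2))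
    rw [Ideal.absNorm_span_singleton, nα2, hn] at hdvd; omega
  · -- 9
    exfalso
    have h9 : ((9 : ℕ) : 𝓞 K) ∈ (I : Ideal (𝓞 K)) := hmemN
    have h3m : ((3 : ℕ) : 𝓞 K) ∈ (I : Ideal (𝓞 K)) := by
      apply hI.mem_of_pow_mem 2
      have : ((3 : ℕ) : 𝓞 K) ^ 2 = ((9 : ℕ) : 𝓞 K) := by push_cast; norm_num
      rwa [this]
    have hprod : (b - ((1 : ℕ) : 𝓞 K)) ^ 2 * (b - ((2 : ℕ) : 𝓞 K)) ∈ (I : Ideal (𝓞 K)) := by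
      have : (b - ((1 : ℕ) : 𝓞 K)) ^ 2 * (b - ((2 : ℕ) : 𝓞 K)) = ((3 : ℕ) : 𝓞 K) * (-(b ^ 2 - 6 * b - 5)) := by
        push_cast; linear_combination hb'
      rw [this]; exact Ideal.mul_mem_right _ _ h3m
    rcases hI.mem_or_mem hprod with h | h
    · have hdvd := Ideal.absNorm_dvd_absNorm_of_le
        ((Ideal.span_singleton_le_iff_mem _).mpr (gen3a (hI.mem_of_pow_mem 2 h) h3m))
      rw [Ideal.absNorm_span_singleton, nα3a, hn] at hdvd; omega
    · have hdvd := Ideal.absNorm_dvd_absNorm_of_le ((Ideal.span_singleton_le_iff_mem _).mpr (gen3b h h3m))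
      rw [Ideal.absNorm_span_singleton, nα3b, hn] at hdvd; omega
  · -- 10
    exfalso
    have h10 : ((10 : ℕ) : 𝓞 K) ∈ (I : Ideal (𝓞 K)) := hmemN
    have : ((10 : ℕ) : 𝓞 K) = ((2 : ℕ) : 𝓞 K) * ((5 : ℕ) : 𝓞 K) := by push_cast; norm_num
    rw [this] at h10
    rcases hI.mem_or_mem h10 with h | h
    · have := hdvl 2 h; norm_num at this
    · have := hdvl 5 h; norm_num at this
  · -- 11: no root
    exfalso
    obtain ⟨a, ha, hab⟩ := exists_sub_natCast_mem_of_absNorm_eq_prime K (by norm_num) hn b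
    have hdvd := natCast_dvd_of_sub_mem K (by norm_num) hn h3 hb hab
    interval_cases a <;> norm_num at hdvd
  · -- 12
    exfalso
    have h12 : ((12 : ℕ) : 𝓞 K) ∈ (I : Ideal (𝓞 K)) := hmemN
    have : ((12 : ℕ) : 𝓞 K) = ((4 : ℕ) : 𝓞 K) * ((3 : ℕ) : 𝓞 K) := by push_cast; norm_num
    rw [this] at h12
    rcases hI.mem_or_mem h12 with h | h
    · have : ((4 : ℕ) : 𝓞 K) = ((2 : ℕ) : 𝓞 K) * ((2 : ℕ) : 𝓞 K) := by push_cast; norm_num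
      rw [this] at h
      have h2 := (hI.mem_or_mem h).elim id id
      have := hdvl 2 h2; norm_num at this
    · have := hdvl 3 h; norm_num at this
  · -- 13
    have h13m : ((13 : ℕ) : 𝓞 K) ∈ (I : Ideal (𝓞 K)) := hmemN
    obtain ⟨a, ha, hab⟩ := exists_sub_natCast_mem_of_absNorm_eq_prime K (by norm_num) hn b
    have hdvd := natCast_dvd_of_sub_mem K (by norm_num) hn h3 hb hab
    interval_cases a
    pick_goal 3
    · refine ⟨⟨_, eq_span_singleton_of_mem_of_absNorm_eq K (by norm_num) hn ?_ nα13⟩⟩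
      have : (((-3 : ℤ) : 𝓞 K) + ((-3 : ℤ) : 𝓞 K) * b + ((-1 : ℤ) : 𝓞 K) * b ^ 2) =
          (b - ((2 : ℕ) : 𝓞 K)) * (-b - 5) + ((13 : ℕ) : 𝓞 K) * (-1) := by push_cast; ring
      rw [this]; exact Ideal.add_mem _ (Ideal.mul_mem_right _ _ hab) (Ideal.mul_mem_right _ _ h13m)
    all_goals norm_num at hdvd
  · -- 14
    exfalso
    have h14 : ((14 : ℕ) : 𝓞 K) ∈ (I : Ideal (𝓞 K)) := hmemN
    have : ((14 : ℕ) : 𝓞 K) = ((2 : ℕ) : 𝓞 K) * ((7 : ℕ) : 𝓞 K) := by push_cast; norm_num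
    rw [this] at h14
    rcases hI.mem_or_mem h14 with h | h
    · have := hdvl 2 h; norm_num at this
    · have := hdvl 7 h; norm_num at this
  · -- 15
    exfalso
    have h15 : ((15 : ℕ) : 𝓞 K) ∈ (I : Ideal (𝓞 K)) := hmemN
    have : ((15 : ℕ) : 𝓞 K) = ((3 : ℕ) : 𝓞 K) * ((5 : ℕ) : 𝓞 K) := by push_cast; norm_num
    rw [this] at h15
    rcases hI.mem_or_mem h15 with h | h
    · have := hdvl 3 h; norm_num at this
    · have := hdvl 5 h; norm_num at this

end Certificate

section Adjoin

/-- `#Cl(𝓞 ℚ(θ)) = 1` for every root `θ` of `X³ − X² − 13X − 17`. KERNEL. [cite: Cohen1993, App. B (d = −2892)] -/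
theorem card_classGroup_adjoin_eq_one_disc_neg2892 {θ : AlgebraicClosure ℚ}
    (hθ : aeval θ (Cubic.toPoly ⟨1, ((-1 : ℤ) : ℚ), ((-13 : ℤ) : ℚ), ((-17 : ℤ) : ℚ)⟩) = 0) :
    Nat.card (ClassGroup (𝓞 (IntermediateField.adjoin ℚ {θ}))) = 1 := by
  have hfm : (Cubic.toPoly ⟨1, ((-1 : ℤ) : ℚ), ((-13 : ℤ) : ℚ), ((-17 : ℤ) : ℚ)⟩).Monic := Cubic.monic_of_a_eq_one'
  have hθint : IsIntegral ℚ θ := ⟨_, hfm, by rwa [← aeval_def]⟩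
  haveI : FiniteDimensional ℚ (IntermediateField.adjoin ℚ {θ}) := IntermediateField.adjoin.finiteDimensional hθint
  haveI : NumberField (IntermediateField.adjoin ℚ {θ}) := NumberField.mk
  obtain ⟨b, -, hb⟩ := exists_ringOfIntegers_cubic_root (p := -1) (q := -13) (r := -17) hθ
  have h1 := classNumber_eq_one_of_root_disc_neg2892 _
    (finrank_adjoin_eq_three_of_irreducible irreducible_cubic_disc_neg2892 hθ) b hb
  rw [NumberField.classNumber, ← Nat.card_eq_fintype_card] at h1
  exact h1

/-- **Iwasawa's `μ₂ = 0` for the cubic field of discriminant `−2892`** (`ℚ(θ)`, `θ³ = θ² + 13θ + 17`; `2 = 𝔭³`, `h = 1`): along EVERY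
`ℤ₂`-extension of `ℚ(θ)`, UNCONDITIONAL. [cite: Greenberg2001IwasawaPastPresent, Prop. 2.1 p. 339] [cite: Cohen1993, App. B (d = −2892)] -/
theorem classicalMuVanishes_cubicField_disc_neg2892 {θ : AlgebraicClosure ℚ}
    (hθ : aeval θ (Cubic.toPoly ⟨1, ((-1 : ℤ) : ℚ), ((-13 : ℤ) : ℚ), ((-17 : ℤ) : ℚ)⟩) = 0)
    (κ : ZpExtension (IntermediateField.adjoin ℚ {θ}) 2) : ClassicalMuVanishes κ := by
  refine classicalMuVanishes_two_adjoin_of_unique_prime θ (by rw [card_classGroup_adjoin_eq_one_disc_neg2892 hθ]; norm_num) ?_ κ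
  have hroot : aeval (θ + algebraMap ℚ (AlgebraicClosure ℚ) ((1 : ℤ) : ℚ))
      (Cubic.toPoly ⟨1, ((-4 : ℤ) : ℚ), ((-8 : ℤ) : ℚ), ((-6 : ℤ) : ℚ)⟩) = 0 := by
    have := aeval_cubic_shift_int (p := -1) (q := -13) (r := -17) 1 hθ
    norm_num at this ⊢
    exact this
  have h := existsUnique_two_mem_adjoin_of_eisenstein (p := -4) (q := -8) (r := -6) (by decide) (by decide) (by decide)
    (by decide) hroot
  rwa [adjoin_shift_eq] at h

end Adjoin

end Summit.BirchSwinnertonDyer.BirchSwinnertonDyer.Theorems.AddKatoTwo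

end
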